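import Summits.QuantumFields.BalabanUV.Beta.EriceRemainderEnclosureHistoryAutonomyWellPosed

/-!
# EriceRemainderEnclosureHistoryAutonomyConstant — (E37h) THE CONSTANT OF THE AUTONOMY THRESHOLD, LOWER SIDE RAISED FROM 1 TO 5∕2: the
# flow with memory of a functional with ZEROTH MOMENT `M` and floor `b` on ]0,γ] is well-posed (stability, uniqueness, existence, `∃!`) as
# soon as `2·M·γ < 5·b` — (E37b)'s absorption `m·a²·a′ ≤ γ∕b` (with `a′ ≤ γ`) sharpened to `m·a²·a′ ≤ 2γ∕(5b)` by using the asymptotic-freedom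
# decay of BOTH solutions at the scale where the memory acts (`sup_m m·(1∕γ² + m·b)^{−3∕2} = 2γ∕(3√3·b) ≤ 2γ∕(5b)`); with (E37g) the threshold
# constant `τ* = inf{M·γ∕b : non-unique}` is CERTIFIED in `[5∕2, 10]`

Cell `pub-balaban`, β-function sub-cell, BINDER row D4 «RemainderConst leaves for Bałaban's split» (`HOME/BINDER-OWNERS.md`; owner
lineage `b2b-balaban-beta-an4`; this file by co-owner #2 lineage `b2b-balaban-beta-d4-p2`, generation 39), β-FLOW TEAM duty (1),
FREEZE (0) honoured (def-free; node U2's `MemFlow` ∕ `drive` ∕ `picard` ∕ `iterate` ∕ `solution` and profile-free lemmas, (E37b)'s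
`abs_drive_sub_drive_le_zm` ∕ `le_picard_zm` ∕ `lower_le_upper_zm` BY NAME).  Companion of (E37b) (imported) and (E37g)
`EriceRemainderEnclosureHistoryAutonomyDegree` (upper side `τ* ≤ 10`, degree one in γ).

HONEST FRAMING (page 1, verbatim and binding).  *"Discharging BetaPertH makes Bałaban's UV stability UNCONDITIONAL — a real
constructive-QFT result; it is NOT the continuum limit and NOT the Clay problem."*  THIS FILE DISCHARGES NOTHING OF THE KIND.  Pure real
analysis about an ABSTRACT functional with displayed zeroth moment and floor — hypotheses, not facts; nothing of Bałaban's (1.22) or its limit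
functional is asserted.  Row D4 class UNCHANGED (critical-path width 0; instance 0∕1; D4 DISCHARGE NO DATE).  HONEST DEPENDENCY: continuum YM
on T⁴ ⇐ BetaPertH ∧ nine spine estimates (0/9 proved); BetaPertH ⇐ (D1) ∧ (D4) ∧ CAP+tail; G-an2-4 gates asym, D1 and NE2/3/4.

THE POINT.  In (E37b) (as in node U2's §3) the discrepancy of the recursion variables after `m` scales, `≤ m·(M·D + η)`, is converted back to
couplings by the weight `a²·a′` with `a² ≤ 1∕(1∕g_IR² + m·b)` and the crude `a′ ≤ γ`, giving `m·a²·a′ ≤ γ∕b`.  But `a′` is itself a solution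
value at scale `m` and obeys the same asymptotic-freedom envelope, `a′ ≤ (1∕γ² + m·b)^{−1∕2}`; so `m·a²·a′ ≤ m·(1∕γ² + m·b)^{−3∕2}`, whose
supremum over `m` is `2γ∕(3√3·b)` (at `m·b = 2∕γ²`) — here bounded by the rational `2γ∕(5b)` through `25·X·t² ≤ 4·(X+t)³` (§1).  Hence (§2) the
core estimate with `(2M·γ∕(5b))·D`, the contraction constant `q = 2M·γ∕(5b)`, and (§3) stability ∕ uniqueness ∕ existence ∕ `∃!` under
`2·M·γ < 5·b`; every non-unique instance has `5b ≤ 2M·γ`.  With (E37g) (node U2's bump at `M·γ = 10·b`): `τ* ∈ [5∕2, 10]`.  What is NOT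
claimed: the exact constant (this argument's limit is `3√3∕2 ≈ 2.598`; the true `τ*` may be larger); anything about Bałaban's functional.

WHAT IS PROVED ([folklore]; 0 `def`, 0 sorry; suffix `_zc` = «zeroth moment, sharpened constant»).  §1 `cubic_absorption`,
**`weight_mul_le`** (`m·a²·a′ ≤ 2γ∕(5b)`), `weight_le_cube`.  §2 **`abs_picard_sub_le_core_zc`**, **`picard_contraction_zc`**.
§3 **`memFlow_stability_zc`**, **`memFlow_unique_zc`**, `memFlow_eq_of_functional_agree_zc`, `abs_iterate_succ_sub_le_zc`, `tendsto_iterate_zc`,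
`abs_iterate_sub_solution_le_zc`, `solution_seqBox_zc`, `picard_solution_zc`, **`memFlow_solution_zc`**, **`existsUnique_memFlow_zc`**,
`ratio_ge_five_halves_of_two_solutions`.
-/

noncomputable section
open Filter Topology Finset

namespace Summit.QuantumFields.BalabanUV.Beta.EriceRemainderEnclosureHistoryAutonomyConstant

open Literature.MathematicalPhysics.QuantumFieldTheory.Balaban1983to89
open Literature.MathematicalPhysics.QuantumFieldTheory.Balaban1983to89.T4CouplingMatching (abs_sub_le_of_inv_sq)
open Literature.MathematicalPhysics.QuantumFieldTheory.Balaban1983to89.T4ContinuumCoupling (tendsto_of_abs_sub_le_geom)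
open Literature.MathematicalPhysics.QuantumFieldTheory.Balaban1983to89.T4BetaStationary
open Literature.MathematicalPhysics.QuantumFieldTheory.Balaban1983to89.T4BetaFlowWellPosed
open Summit.QuantumFields.BalabanUV.Beta.EriceRemainderEnclosureHistoryAutonomyWellPosed

variable {B B' : (ℕ → ℝ) → ℝ} {M γ b η gIR gIR' : ℝ} {h h' : ℕ → ℝ}

/-! ## §1 The sharper absorption of the linear growth by the asymptotic-freedom weight -/

/-- THE CUBIC ABSORPTION: for `X > 0`, `t ≥ 0`: `25·X·t² ≤ 4·(X + t)³` (indeed `4(X+t)³ − 27Xt² = (t − 2X)²(4t + X) ≥ 0`). [folklore] -/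
theorem cubic_absorption {X t : ℝ} (hX : 0 < X) (ht : 0 ≤ t) : 25 * X * t ^ 2 ≤ 4 * (X + t) ^ 3 := by
  nlinarith [mul_nonneg (sq_nonneg (t - 2 * X)) (by linarith : (0 : ℝ) ≤ 4 * t + X), mul_nonneg hX.le (sq_nonneg t)]

/-- **THE WEIGHT BOUND**: if `0 < a′`, `1∕γ² + m·b ≤ 1∕a²` and `1∕γ² + m·b ≤ 1∕a′²` (both values obey the asymptotic-freedom envelope at scale
`m`), `γ, b > 0`, then `m·(a²·a′) ≤ 2γ∕(5b)`. [folklore] -/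
theorem weight_mul_le {a a' : ℝ} (hγ : 0 < γ) (hb : 0 < b) (ha' : 0 < a') (m : ℕ)
    (haP : 1 / γ ^ 2 + (m : ℝ) * b ≤ 1 / a ^ 2) (ha'P : 1 / γ ^ 2 + (m : ℝ) * b ≤ 1 / a' ^ 2) :
    (m : ℝ) * (a ^ 2 * a') ≤ 2 * γ / (5 * b) := by
  set P : ℝ := 1 / γ ^ 2 + (m : ℝ) * b with hP
  have hX : 0 < 1 / γ ^ 2 := by positivity
  have hmb : (0 : ℝ) ≤ (m : ℝ) * b := mul_nonneg (Nat.cast_nonneg m) hb.le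
  have hP0 : 0 < P := by positivity
  have ha2 : a ^ 2 ≤ 1 / P := by
    have := one_div_le_one_div_of_le (by positivity) haP
    rwa [one_div_one_div] at this
  have ha'2 : a' ^ 2 ≤ 1 / P := by
    have := one_div_le_one_div_of_le (by positivity) ha'P
    rwa [one_div_one_div] at this
  have hsP : 0 < Real.sqrt P := Real.sqrt_pos.2 hP0
  have ha'1 : a' ≤ 1 / Real.sqrt P := by
    rw [le_div_iff₀ hsP]
    -- (a'·√P)² ≤ 1
    have h1 : (a' * Real.sqrt P) ^ 2 ≤ 1 := by
      rw [mul_pow, Real.sq_sqrt hP0.le]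
      calc a' ^ 2 * P ≤ 1 / P * P := mul_le_mul_of_nonneg_right ha'2 hP0.le
        _ = 1 := by field_simp
    have h2 : 0 ≤ a' * Real.sqrt P := by positivity
    nlinarith
  have hw : a ^ 2 * a' ≤ 1 / P * (1 / Real.sqrt P) := mul_le_mul ha2 ha'1 ha'.le (by positivity)
  have hsq : (5 * b * (m : ℝ)) ^ 2 ≤ (2 * γ * (P * Real.sqrt P)) ^ 2 := by
    have hcub := cubic_absorption hX hmb
    have e1 : (2 * γ * (P * Real.sqrt P)) ^ 2 = 4 * γ ^ 2 * P ^ 3 := by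
      rw [show (2 * γ * (P * Real.sqrt P)) ^ 2 = 4 * γ ^ 2 * P ^ 2 * (Real.sqrt P) ^ 2 by ring, Real.sq_sqrt hP0.le]; ring
    have e2 : (5 * b * (m : ℝ)) ^ 2 = γ ^ 2 * (25 * (1 / γ ^ 2) * ((m : ℝ) * b) ^ 2) := by
      field_simp
      ring
    rw [e1, e2]
    have h3 : γ ^ 2 * (25 * (1 / γ ^ 2) * ((m : ℝ) * b) ^ 2) ≤ γ ^ 2 * (4 * (1 / γ ^ 2 + (m : ℝ) * b) ^ 3) :=
      mul_le_mul_of_nonneg_left hcub (by positivity)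
    have e3 : γ ^ 2 * (4 * (1 / γ ^ 2 + (m : ℝ) * b) ^ 3) = 4 * γ ^ 2 * P ^ 3 := by rw [hP]; ring
    linarith [h3, e3]
  have hle : 5 * b * (m : ℝ) ≤ 2 * γ * (P * Real.sqrt P) :=
    (pow_le_pow_iff_left₀ (by positivity) (by positivity) two_ne_zero).1 hsq
  have hkey : (m : ℝ) * (1 / P * (1 / Real.sqrt P)) ≤ 2 * γ / (5 * b) := by
    rw [show (m : ℝ) * (1 / P * (1 / Real.sqrt P)) = (m : ℝ) / (P * Real.sqrt P) by field_simp,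
      div_le_div_iff₀ (by positivity) (by positivity)]
    nlinarith
  calc (m : ℝ) * (a ^ 2 * a') ≤ (m : ℝ) * (1 / P * (1 / Real.sqrt P)) := mul_le_mul_of_nonneg_left hw (Nat.cast_nonneg m)
    _ ≤ 2 * γ / (5 * b) := hkey

/-- The pin weight under the same envelope: `a²·a′ ≤ γ³`. [folklore] -/
theorem weight_le_cube {a a' : ℝ} (hγ : 0 < γ) (hb : 0 < b) (ha : 0 < a) (ha' : 0 < a') (m : ℕ)
    (haP : 1 / γ ^ 2 + (m : ℝ) * b ≤ 1 / a ^ 2) (ha'P : 1 / γ ^ 2 + (m : ℝ) * b ≤ 1 / a' ^ 2) : a ^ 2 * a' ≤ γ ^ 3 := by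
  have hmb : (0 : ℝ) ≤ (m : ℝ) * b := mul_nonneg (Nat.cast_nonneg m) hb.le
  have haγ : a ≤ γ := by
    have h1 : 1 / γ ^ 2 ≤ 1 / a ^ 2 := by linarith
    have h2 : a ^ 2 ≤ γ ^ 2 := (one_div_le_one_div (by positivity) (by positivity)).1 h1
    exact (pow_le_pow_iff_left₀ ha.le hγ.le two_ne_zero).1 h2
  have ha'γ : a' ≤ γ := by
    have h1 : 1 / γ ^ 2 ≤ 1 / a' ^ 2 := by linarith
    have h2 : a' ^ 2 ≤ γ ^ 2 := (one_div_le_one_div (by positivity) (by positivity)).1 h1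
    exact (pow_le_pow_iff_left₀ ha'.le hγ.le two_ne_zero).1 h2
  calc a ^ 2 * a' ≤ γ ^ 2 * γ := mul_le_mul (pow_le_pow_left₀ ha.le haγ 2) ha'γ ha'.le (by positivity)
    _ = γ ^ 3 := by ring

/-! ## §2 The core estimate and the contraction with the sharpened constant -/

/-- **THE CORE ESTIMATE, SHARPENED**: `B` with zeroth moment `M ≥ 0`, `B` AND `B′` with floor `b > 0` on the box ]0,γ], `B′` within `η` of `B`;
pins `gIR, gIR′ ∈ ]0,γ]`; box histories `h, h′` entrywise `D`-close; `a′ > 0` with `1∕a′² = 1∕gIR′² + drive B′ h′ m`.  Then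
`|picard B gIR h m − a′| ≤ γ³·|1∕gIR² − 1∕gIR′²| + (2γ∕(5b))·η + (2M·γ∕(5b))·D`. [folklore] -/
theorem abs_picard_sub_le_core_zc
    (hB : ∀ u u' : ℕ → ℝ, SeqBox γ u → SeqBox γ u' → ∀ D : ℝ, (∀ j, |u j - u' j| ≤ D) → |B u - B u'| ≤ M * D)
    (hM : 0 ≤ M) (hgIR : 0 < gIR) (hgIRγ : gIR ≤ γ) (hgIR' : 0 < gIR') (hgIR'γ : gIR' ≤ γ) (hb : 0 < b)
    (hlo : ∀ u, SeqBox γ u → b ≤ B u) (hlo' : ∀ u, SeqBox γ u → b ≤ B' u)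
    (hη : ∀ u, SeqBox γ u → |B u - B' u| ≤ η) (hh : SeqBox γ h) (hh' : SeqBox γ h') {D : ℝ}
    (hD : ∀ i, |h i - h' i| ≤ D) (m : ℕ) {a' : ℝ} (ha' : 0 < a')
    (hSa' : 1 / a' ^ 2 = 1 / gIR' ^ 2 + drive B' h' m) :
    |picard B gIR h m - a'| ≤ γ ^ 3 * |1 / gIR ^ 2 - 1 / gIR' ^ 2| + 2 * γ / (5 * b) * η + 2 * M * γ / (5 * b) * D := by
  have hγ : 0 < γ := lt_of_lt_of_le hgIR hgIRγ
  have hη0 : 0 ≤ η := (abs_nonneg _).trans (hη _ (seqBox_const hγ))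
  have hD0 : 0 ≤ D := (abs_nonneg _).trans (hD 0)
  set a := picard B gIR h m with ha_def
  have ha : 0 < a := picard_pos hgIR hb hlo hh m
  have hSa : 1 / a ^ 2 = 1 / gIR ^ 2 + drive B h m := one_div_picard_sq hgIR hb hlo hh m
  -- both values obey the envelope at scale m
  have hpin : 1 / γ ^ 2 ≤ 1 / gIR ^ 2 := one_div_le_one_div_of_le (by positivity) (pow_le_pow_left₀ hgIR.le hgIRγ 2)
  have hpin' : 1 / γ ^ 2 ≤ 1 / gIR' ^ 2 := one_div_le_one_div_of_le (by positivity) (pow_le_pow_left₀ hgIR'.le hgIR'γ 2)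
  have haP : 1 / γ ^ 2 + (m : ℝ) * b ≤ 1 / a ^ 2 := by
    rw [hSa]; exact add_le_add hpin (mul_lower_le_drive hlo hh m)
  have ha'P : 1 / γ ^ 2 + (m : ℝ) * b ≤ 1 / a' ^ 2 := by
    rw [hSa']; exact add_le_add hpin' (mul_lower_le_drive hlo' hh' m)
  have hw := abs_sub_le_of_inv_sq ha ha'
  have hdiff : |1 / a ^ 2 - 1 / a' ^ 2| ≤ |1 / gIR ^ 2 - 1 / gIR' ^ 2| + (m : ℝ) * (M * D + η) := by
    rw [hSa, hSa']
    calc |1 / gIR ^ 2 + drive B h m - (1 / gIR' ^ 2 + drive B' h' m)|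
        = |(1 / gIR ^ 2 - 1 / gIR' ^ 2) + (drive B h m - drive B' h' m)| := by ring_nf
      _ ≤ |1 / gIR ^ 2 - 1 / gIR' ^ 2| + |drive B h m - drive B' h' m| := abs_add_le _ _
      _ ≤ |1 / gIR ^ 2 - 1 / gIR' ^ 2| + (m : ℝ) * (M * D + η) :=
          add_le_add le_rfl (abs_drive_sub_drive_le_zm hB hη hh hh' hD m)
  have hW1 := weight_le_cube hγ hb ha ha' m haP ha'P
  have hW2 := weight_mul_le hγ hb ha' m haP ha'P
  have hΔ0 : 0 ≤ |1 / gIR ^ 2 - 1 / gIR' ^ 2| := abs_nonneg _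
  have hE0 : 0 ≤ M * D + η := by positivity
  calc |a - a'| ≤ a ^ 2 * a' * |1 / a ^ 2 - 1 / a' ^ 2| := hw
    _ ≤ a ^ 2 * a' * (|1 / gIR ^ 2 - 1 / gIR' ^ 2| + (m : ℝ) * (M * D + η)) :=
        mul_le_mul_of_nonneg_left hdiff (by positivity)
    _ = a ^ 2 * a' * |1 / gIR ^ 2 - 1 / gIR' ^ 2| + (m : ℝ) * (a ^ 2 * a') * (M * D + η) := by ring
    _ ≤ γ ^ 3 * |1 / gIR ^ 2 - 1 / gIR' ^ 2| + 2 * γ / (5 * b) * (M * D + η) :=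
        add_le_add (mul_le_mul_of_nonneg_right hW1 hΔ0) (mul_le_mul_of_nonneg_right hW2 hE0)
    _ = γ ^ 3 * |1 / gIR ^ 2 - 1 / gIR' ^ 2| + 2 * γ / (5 * b) * η + 2 * M * γ / (5 * b) * D := by ring

/-- **THE SOLUTION MAP IS A `2M·γ∕(5b)`-CONTRACTION IN THE SUPREMUM DISTANCE ON THE BOX.** [folklore] -/
theorem picard_contraction_zc
    (hB : ∀ u u' : ℕ → ℝ, SeqBox γ u → SeqBox γ u' → ∀ D : ℝ, (∀ j, |u j - u' j| ≤ D) → |B u - B u'| ≤ M * D)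
    (hM : 0 ≤ M) (hgIR : 0 < gIR) (hgIRγ : gIR ≤ γ) (hb : 0 < b) (hlo : ∀ u, SeqBox γ u → b ≤ B u) (hh : SeqBox γ h)
    (hh' : SeqBox γ h') {D : ℝ} (hD : ∀ i, |h i - h' i| ≤ D) (m : ℕ) :
    |picard B gIR h m - picard B gIR h' m| ≤ 2 * M * γ / (5 * b) * D := by
  have h0 : ∀ u, SeqBox γ u → |B u - B u| ≤ 0 := fun u _ => by simp
  have := abs_picard_sub_le_core_zc hB hM hgIR hgIRγ hgIR hgIRγ hb hlo hlo h0 hh hh' hD m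
    (picard_pos hgIR hb hlo hh' m) (one_div_picard_sq hgIR hb hlo hh' m)
  simpa using this

/-- The sharpened contraction constant is in `[0,1[` under `2M·γ < 5b`. [folklore] -/
theorem contraction_const_zc (hM : 0 ≤ M) (hγ : 0 ≤ γ) (hb : 0 < b) (hsmall : 2 * M * γ < 5 * b) :
    0 ≤ 2 * M * γ / (5 * b) ∧ 2 * M * γ / (5 * b) < 1 :=
  ⟨div_nonneg (by positivity) (by positivity), (div_lt_one (by positivity)).2 hsmall⟩

/-! ## §3 Well-posedness under `2·M·γ < 5·b` -/

/-- **STABILITY, SHARPENED**: `B` (zeroth moment `M`, floor `b`), `B′` (floor `b`, within `η` of `B`), `2M·γ < 5b`: a box solution of `(B, gIR)`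
and any box solution of `(B′, gIR′)` satisfy `|h m − h′ m| ≤ (γ³·|1∕gIR² − 1∕gIR′²| + (2γ∕(5b))·η)∕(1 − 2M·γ∕(5b))` at every scale. [folklore] -/
theorem memFlow_stability_zc
    (hB : ∀ u u' : ℕ → ℝ, SeqBox γ u → SeqBox γ u' → ∀ D : ℝ, (∀ j, |u j - u' j| ≤ D) → |B u - B u'| ≤ M * D)
    (hM : 0 ≤ M) (hgIR : 0 < gIR) (hgIRγ : gIR ≤ γ) (hgIR' : 0 < gIR') (hgIR'γ : gIR' ≤ γ) (hb : 0 < b)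
    (hlo : ∀ u, SeqBox γ u → b ≤ B u) (hlo' : ∀ u, SeqBox γ u → b ≤ B' u) (hsmall : 2 * M * γ < 5 * b)
    (hη : ∀ u, SeqBox γ u → |B u - B' u| ≤ η) (hh : SeqBox γ h) (hh' : SeqBox γ h') (hf : MemFlow B gIR h)
    (hf' : MemFlow B' gIR' h') (m : ℕ) :
    |h m - h' m| ≤ (γ ^ 3 * |1 / gIR ^ 2 - 1 / gIR' ^ 2| + 2 * γ / (5 * b) * η) / (1 - 2 * M * γ / (5 * b)) := by
  have hγ : 0 < γ := lt_of_lt_of_le hgIR hgIRγ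
  have hη0 : 0 ≤ η := (abs_nonneg _).trans (hη _ (seqBox_const hγ))
  obtain ⟨hq0, hq1⟩ := contraction_const_zc hM hγ.le hb hsmall
  refine le_of_affine_contraction (δ := fun i => |h i - h' i|) hq0 hq1 (by positivity)
    (fun i => abs_sub_le_of_seqBox hh hh' i) (fun D hD i => ?_) m
  have hfix := picard_eq_of_memFlow hf (fun m => (hh m).1)
  have := abs_picard_sub_le_core_zc hB hM hgIR hgIRγ hgIR' hgIR'γ hb hlo hlo' hη hh hh' hD i (hh' i).1
    (invSq_eq_of_memFlow hf' i)
  rw [hfix] at this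
  linarith

/-- **UNIQUENESS UNDER `2·M·γ < 5·b`.** [folklore] -/
theorem memFlow_unique_zc
    (hB : ∀ u u' : ℕ → ℝ, SeqBox γ u → SeqBox γ u' → ∀ D : ℝ, (∀ j, |u j - u' j| ≤ D) → |B u - B u'| ≤ M * D)
    (hM : 0 ≤ M) (hgIR : 0 < gIR) (hgIRγ : gIR ≤ γ) (hb : 0 < b) (hlo : ∀ u, SeqBox γ u → b ≤ B u)
    (hsmall : 2 * M * γ < 5 * b) (hh : SeqBox γ h) (hh' : SeqBox γ h') (hf : MemFlow B gIR h)
    (hf' : MemFlow B gIR h') : h = h' := by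
  funext m
  have := memFlow_stability_zc hB hM hgIR hgIRγ hgIR hgIRγ hb hlo hlo hsmall
    (fun u _ => by simp : ∀ u, SeqBox γ u → |B u - B u| ≤ 0) hh hh' hf hf' m
  simp only [sub_self, abs_zero, mul_zero, zero_add, zero_div] at this
  exact eq_of_abs_sub_nonpos this

/-- Conversely: two distinct box solutions from one pin force `5b ≤ 2M·γ`. [folklore] -/
theorem ratio_ge_five_halves_of_two_solutions
    (hB : ∀ u u' : ℕ → ℝ, SeqBox γ u → SeqBox γ u' → ∀ D : ℝ, (∀ j, |u j - u' j| ≤ D) → |B u - B u'| ≤ M * D)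
    (hM : 0 ≤ M) (hgIR : 0 < gIR) (hgIRγ : gIR ≤ γ) (hb : 0 < b) (hlo : ∀ u, SeqBox γ u → b ≤ B u)
    (hh : SeqBox γ h) (hh' : SeqBox γ h') (hf : MemFlow B gIR h) (hf' : MemFlow B gIR h') (hne : h ≠ h') :
    5 * b ≤ 2 * M * γ :=
  not_lt.1 fun hsmall => hne (memFlow_unique_zc hB hM hgIR hgIRγ hb hlo hsmall hh hh' hf hf')

/-- UNIVERSALITY under `2·M·γ < 5·b`: two functionals with floor `b` that agree on the box generate the same box solution. [folklore] -/
theorem memFlow_eq_of_functional_agree_zc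
    (hB : ∀ u u' : ℕ → ℝ, SeqBox γ u → SeqBox γ u' → ∀ D : ℝ, (∀ j, |u j - u' j| ≤ D) → |B u - B u'| ≤ M * D)
    (hM : 0 ≤ M) (hgIR : 0 < gIR) (hgIRγ : gIR ≤ γ) (hb : 0 < b) (hlo : ∀ u, SeqBox γ u → b ≤ B u)
    (hsmall : 2 * M * γ < 5 * b) (hagree : ∀ u, SeqBox γ u → B u = B' u) (hh : SeqBox γ h)
    (hh' : SeqBox γ h') (hf : MemFlow B gIR h) (hf' : MemFlow B' gIR h') : h = h' := by
  funext m
  have hlo' : ∀ u, SeqBox γ u → b ≤ B' u := fun u hu => hagree u hu ▸ hlo u hu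
  have h0 : ∀ u, SeqBox γ u → |B u - B' u| ≤ 0 := fun u hu => by simp [hagree u hu]
  have := memFlow_stability_zc hB hM hgIR hgIRγ hgIR hgIRγ hb hlo hlo' hsmall h0 hh hh' hf hf' m
  simp only [sub_self, abs_zero, mul_zero, zero_add, zero_div] at this
  exact eq_of_abs_sub_nonpos this

/-- Consecutive Picard iterates are `γ·qⁿ`-close, `q = 2M·γ∕(5b)`. [folklore] -/
theorem abs_iterate_succ_sub_le_zc
    (hB : ∀ u u' : ℕ → ℝ, SeqBox γ u → SeqBox γ u' → ∀ D : ℝ, (∀ j, |u j - u' j| ≤ D) → |B u - B u'| ≤ M * D)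
    (hM : 0 ≤ M) (hgIR : 0 < gIR) (hgIRγ : gIR ≤ γ) (hb : 0 < b) (hlo : ∀ u, SeqBox γ u → b ≤ B u) :
    ∀ n m, |iterate B gIR (n + 1) m - iterate B gIR n m| ≤ γ * (2 * M * γ / (5 * b)) ^ n := by
  intro n
  induction n with
  | zero =>
    intro m
    simpa using abs_sub_le_of_seqBox (iterate_seqBox hgIR hgIRγ hb hlo 1) (iterate_seqBox hgIR hgIRγ hb hlo 0) m
  | succ n ih =>
    intro m
    have := picard_contraction_zc hB hM hgIR hgIRγ hb hlo (iterate_seqBox hgIR hgIRγ hb hlo (n + 1))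
      (iterate_seqBox hgIR hgIRγ hb hlo n) ih m
    calc |iterate B gIR (n + 1 + 1) m - iterate B gIR (n + 1) m|
        = |picard B gIR (iterate B gIR (n + 1)) m - picard B gIR (iterate B gIR n) m| := rfl
      _ ≤ 2 * M * γ / (5 * b) * (γ * (2 * M * γ / (5 * b)) ^ n) := this
      _ = γ * (2 * M * γ / (5 * b)) ^ (n + 1) := by ring

/-- The iterates converge scale-wise. [folklore] -/
theorem tendsto_iterate_zc
    (hB : ∀ u u' : ℕ → ℝ, SeqBox γ u → SeqBox γ u' → ∀ D : ℝ, (∀ j, |u j - u' j| ≤ D) → |B u - B u'| ≤ M * D)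
    (hM : 0 ≤ M) (hgIR : 0 < gIR) (hgIRγ : gIR ≤ γ) (hb : 0 < b) (hlo : ∀ u, SeqBox γ u → b ≤ B u)
    (hsmall : 2 * M * γ < 5 * b) (m : ℕ) :
    Tendsto (fun n => iterate B gIR n m) atTop (𝓝 (solution B gIR m)) := by
  have hq1 := (contraction_const_zc hM (hgIR.le.trans hgIRγ) hb hsmall).2
  have hc : CauchySeq fun n => iterate B gIR n m := by
    refine cauchySeq_of_le_geometric (2 * M * γ / (5 * b)) γ hq1 fun n => ?_
    rw [Real.dist_eq, abs_sub_comm]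
    exact abs_iterate_succ_sub_le_zc hB hM hgIR hgIRγ hb hlo n m
  exact tendsto_nhds_limUnder (cauchySeq_tendsto_of_complete hc)

/-- Geometric rate of the scale-wise convergence. [folklore] -/
theorem abs_iterate_sub_solution_le_zc
    (hB : ∀ u u' : ℕ → ℝ, SeqBox γ u → SeqBox γ u' → ∀ D : ℝ, (∀ j, |u j - u' j| ≤ D) → |B u - B u'| ≤ M * D)
    (hM : 0 ≤ M) (hgIR : 0 < gIR) (hgIRγ : gIR ≤ γ) (hb : 0 < b) (hlo : ∀ u, SeqBox γ u → b ≤ B u)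
    (hsmall : 2 * M * γ < 5 * b) (n m : ℕ) :
    |iterate B gIR n m - solution B gIR m| ≤ γ * (2 * M * γ / (5 * b)) ^ n / (1 - 2 * M * γ / (5 * b)) := by
  have hq1 := (contraction_const_zc hM (hgIR.le.trans hgIRγ) hb hsmall).2
  have h := dist_le_of_le_geometric_of_tendsto (2 * M * γ / (5 * b)) γ hq1
    (fun n => by
      rw [Real.dist_eq, abs_sub_comm]
      exact abs_iterate_succ_sub_le_zc hB hM hgIR hgIRγ hb hlo n m)
    (tendsto_iterate_zc hB hM hgIR hgIRγ hb hlo hsmall m) n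
  rwa [Real.dist_eq] at h

/-- The scale-wise limit is box-valued. [folklore] -/
theorem solution_seqBox_zc
    (hB : ∀ u u' : ℕ → ℝ, SeqBox γ u → SeqBox γ u' → ∀ D : ℝ, (∀ j, |u j - u' j| ≤ D) → |B u - B u'| ≤ M * D)
    (hM : 0 ≤ M) (hgIR : 0 < gIR) (hgIRγ : gIR ≤ γ) (hb : 0 < b) (hlo : ∀ u, SeqBox γ u → b ≤ B u)
    (hsmall : 2 * M * γ < 5 * b) : SeqBox γ (solution B gIR) := by
  have hγ : 0 < γ := lt_of_lt_of_le hgIR hgIRγ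
  intro m
  have ht := tendsto_iterate_zc hB hM hgIR hgIRγ hb hlo hsmall m
  have hup : b ≤ B (fun _ => γ) + M * γ := lower_le_upper_zm hM hγ hlo
  have hbb : 0 < 1 / gIR ^ 2 + (m : ℝ) * (B (fun _ => γ) + M * γ) := by
    have : 0 ≤ (m : ℝ) * (B (fun _ => γ) + M * γ) := mul_nonneg (Nat.cast_nonneg m) (hb.le.trans hup)
    positivity
  have hlow : ∀ n, 1 / Real.sqrt (1 / gIR ^ 2 + (m : ℝ) * (B (fun _ => γ) + M * γ)) ≤ iterate B gIR n m := by
    intro n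
    cases n with
    | zero =>
      simp only [iterate_zero]
      refine one_div_sqrt_le hgIR (le_add_of_nonneg_right ?_)
      exact mul_nonneg (Nat.cast_nonneg m) (hb.le.trans hup)
    | succ n =>
      exact le_picard_zm hB hγ hgIR hb hlo (iterate_seqBox hgIR hgIRγ hb hlo n) m
  refine ⟨lt_of_lt_of_le (one_div_pos.mpr (Real.sqrt_pos.mpr hbb)) (ge_of_tendsto' ht hlow), ?_⟩
  exact le_of_tendsto' ht fun n => (iterate_seqBox hgIR hgIRγ hb hlo n m).2

/-- The limit is a fixed point of the solution map. [folklore] -/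
theorem picard_solution_zc
    (hB : ∀ u u' : ℕ → ℝ, SeqBox γ u → SeqBox γ u' → ∀ D : ℝ, (∀ j, |u j - u' j| ≤ D) → |B u - B u'| ≤ M * D)
    (hM : 0 ≤ M) (hgIR : 0 < gIR) (hgIRγ : gIR ≤ γ) (hb : 0 < b) (hlo : ∀ u, SeqBox γ u → b ≤ B u)
    (hsmall : 2 * M * γ < 5 * b) : picard B gIR (solution B gIR) = solution B gIR := by
  have hγ : 0 < γ := lt_of_lt_of_le hgIR hgIRγ
  set q := 2 * M * γ / (5 * b) with hq
  obtain ⟨hq0, hq1⟩ := contraction_const_zc hM hγ.le hb hsmall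
  have hsol := solution_seqBox_zc hB hM hgIR hgIRγ hb hlo hsmall
  funext m
  have h1 : Tendsto (fun n => iterate B gIR (n + 1) m) atTop (𝓝 (picard B gIR (solution B gIR) m)) := by
    refine tendsto_of_abs_sub_le_geom (c := q * (γ / (1 - q))) hq0 hq1 fun n => ?_
    have hD : ∀ i, |iterate B gIR n i - solution B gIR i| ≤ γ * q ^ n / (1 - q) := fun i =>
      abs_iterate_sub_solution_le_zc hB hM hgIR hgIRγ hb hlo hsmall n i
    have := picard_contraction_zc hB hM hgIR hgIRγ hb hlo (iterate_seqBox hgIR hgIRγ hb hlo n) hsol hD m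
    calc |iterate B gIR (n + 1) m - picard B gIR (solution B gIR) m|
        = |picard B gIR (iterate B gIR n) m - picard B gIR (solution B gIR) m| := rfl
      _ ≤ q * (γ * q ^ n / (1 - q)) := this
      _ = q * (γ / (1 - q)) * q ^ n := by ring
  have h2 : Tendsto (fun n => iterate B gIR (n + 1) m) atTop (𝓝 (solution B gIR m)) :=
    (tendsto_iterate_zc hB hM hgIR hgIRγ hb hlo hsmall m).comp (tendsto_add_atTop_nat 1)
  exact tendsto_nhds_unique h1 h2

/-- **EXISTENCE UNDER `2·M·γ < 5·b`**. [folklore] -/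
theorem memFlow_solution_zc
    (hB : ∀ u u' : ℕ → ℝ, SeqBox γ u → SeqBox γ u' → ∀ D : ℝ, (∀ j, |u j - u' j| ≤ D) → |B u - B u'| ≤ M * D)
    (hM : 0 ≤ M) (hgIR : 0 < gIR) (hgIRγ : gIR ≤ γ) (hb : 0 < b) (hlo : ∀ u, SeqBox γ u → b ≤ B u)
    (hsmall : 2 * M * γ < 5 * b) : MemFlow B gIR (solution B gIR) :=
  memFlow_of_picard_eq hgIR hb hlo (solution_seqBox_zc hB hM hgIR hgIRγ hb hlo hsmall)
    (picard_solution_zc hB hM hgIR hgIRγ hb hlo hsmall)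

/-- **WELL-POSEDNESS UNDER `2·M·γ < 5·b`**: exactly one box solution per pin. [folklore] -/
theorem existsUnique_memFlow_zc
    (hB : ∀ u u' : ℕ → ℝ, SeqBox γ u → SeqBox γ u' → ∀ D : ℝ, (∀ j, |u j - u' j| ≤ D) → |B u - B u'| ≤ M * D)
    (hM : 0 ≤ M) (hgIR : 0 < gIR) (hgIRγ : gIR ≤ γ) (hb : 0 < b) (hlo : ∀ u, SeqBox γ u → b ≤ B u)
    (hsmall : 2 * M * γ < 5 * b) : ∃! h : ℕ → ℝ, SeqBox γ h ∧ MemFlow B gIR h :=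
  ⟨solution B gIR, ⟨solution_seqBox_zc hB hM hgIR hgIRγ hb hlo hsmall, memFlow_solution_zc hB hM hgIR hgIRγ hb hlo hsmall⟩,
    fun _ hh => memFlow_unique_zc hB hM hgIR hgIRγ hb hlo hsmall hh.1 (solution_seqBox_zc hB hM hgIR hgIRγ hb hlo hsmall)
      hh.2 (memFlow_solution_zc hB hM hgIR hgIRγ hb hlo hsmall)⟩

end Summit.QuantumFields.BalabanUV.Beta.EriceRemainderEnclosureHistoryAutonomyConstant

end
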